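import Literature.NumberTheory.Automorphic.CuspidalMautnerGL2
import Literature.NumberTheory.Automorphic.CuspFormsGenericGLn
import Literature.NumberTheory.Automorphic.CuspFormsRapidDecayUnipotentArch
import Literature.NumberTheory.Automorphic.AdelicPiSchwartzBruhatFourier
import Literature.NumberTheory.Automorphic.ArchComplexPlaceCasimir
import Literature.NumberTheory.Automorphic.AutomorphicFormsSpan
import Literature.NumberTheory.Automorphic.ImaginaryQuadraticArchimedeanGL
import HarnessLib

/-!
# A cusp form on `GL₂` invariant under the archimedean unipotents vanishes; cusp forms killed by
# `𝔰𝔩₂` at the (unique) complex place vanish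

Two vanishing statements for cusp forms `φ ∈ 𝒜₀` on `GL₂(𝔸_K)`:

* `eq_zero_of_archUnipotent_mul` — **if `φ(n_∞ g) = φ(g)` for all archimedean upper unipotents
  `n_∞ = (1 + e E₁₂, 1)` then `φ = 0`.**  The global Whittaker coefficient satisfies
  `W_φ(n_∞ g) = ψ(n_∞) W_φ(g)` (`whittakerCoeff_unipotent_mul`) and `W_φ(n_∞ g) = W_φ(g)` (`N₂` is
  abelian), while Tate's character is `-1` on a suitable `n_∞` (`adeleAddChar_infiniteAdeleInl`,
  trace `½`); so `W_φ ≡ 0` and `φ = 0` by the genericity of cusp forms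
  (`IsCuspFormGL.eq_zero_of_whittakerCoeff_eq_zero`, Shalika 1974, Thm. 5.9).
* `eq_zero_of_lieDeriv_placeLie_eq_zero` — for `K` with a single infinite place, complex (`w₀`):
  **if `X φ = 0` for every `X = φ_{w₀}(Y)`, `Y ∈ 𝔰𝔩₂(ℂ)`, then `φ = 0`**: the derivative of
  `s ↦ φ((1 + s e E₁₂) g)` is the Lie derivative along the twisted direction
  `Ad(g_∞⁻¹)(e E₁₂)` (`IsArchSmooth.hasDerivAt_archUnipotent`, Moeglin–Waldspurger I.2.10), a
  trace-zero matrix at `w₀`, hence `0`; so `φ` is invariant under the archimedean unipotents.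
  This is the input "no non-zero `𝔰𝔩₂(ℂ)`-invariants among cusp forms" (`hnoinv`) of the
  lowest-`K`-type theorem `GL2CUnitaryKTypes.exists_isHW_two_mul` in the Eichler–Shimura–Harder
  construction. [cite: Harder1987, §3.1] [cite: Shalika1974, §5 Thm. 5.9]

Theorems only (and the abbreviation `pos₀₁`); no named fact.
-/

noncomputable section

-- Mathlib idiom (Mathlib/Algebra/Lie/OfAssociative.lean), as in `TestFunctionLieDeriv`.
attribute [local instance 100] LieRing.ofAssociativeRing

open scoped Matrix MatrixGroups ComplexConjugate Classical
open Complex NumberField NumberField.mixedEmbedding NumberField.InfinitePlace IsDedekindDomain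
open _root_.MeasureTheory _root_.MeasureTheory.Measure

namespace Literature.NumberTheory.Automorphic

namespace GL2ArchUnipotent

variable {K : Type} [Field K] [NumberField K]

-- the Borel structures on `GL_n(𝔸_K)` (as in `CuspidalMautnerGL2`)
attribute [local instance] adelicBorel borelSpace_adelic locallyCompactSpace_adelic
  secondCountableTopology_gl_adelic glAdeleBorel borelSpace_glAdele

/-! ### The archimedean upper unipotents of `GL₂` -/

/-- The position `(0, 1)` of the `1 × 1` upper right block of `GL₂`. [folklore] -/
abbrev pos₀₁ : BlockPos 2 1 := ⟨(0, 1), by decide⟩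

/-- It is the only block position. [folklore] -/
theorem eq_pos₀₁ (p : BlockPos 2 1) : p = pos₀₁ := by
  obtain ⟨⟨i, j⟩, hi, hj⟩ := p
  have hi' : (i : ℕ) < 1 := hi
  have hj' : 1 ≤ (j : ℕ) := hj
  have hj2 := j.2
  refine Subtype.ext (Prod.ext (Fin.ext ?_) (Fin.ext ?_))
  · change (i : ℕ) = 0; omega
  · change (j : ℕ) = 1; omega

/-- `archUnipotent e ∈ N₂(𝔸_K)`. [folklore] -/
theorem archUnipotent_mem (e : ArchBlockSpace 2 1 K) : archUnipotent 2 1 K e ∈ adelicUnipotent 2 K := by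
  rw [mem_upperUnitriangular_iff, archUnipotent_def, glUnipotent_apply, coe_unipotentOfBlock, toAdd_ofAdd]
  refine ⟨fun i j hij => ?_, fun i => ?_⟩
  · have hne : i ≠ j := fun h => by subst h; exact lt_irrefl _ hij
    rw [Matrix.add_apply, Matrix.one_apply_ne hne, zero_add]
    by_contra h
    have h1 := (archBlock 2 1 K e).2 i j h
    have : (j : ℕ) < (i : ℕ) := hij
    omega
  · rw [Matrix.add_apply, Matrix.one_apply_eq, add_eq_left]
    by_contra h
    have h1 := (archBlock 2 1 K e).2 i i h
    omega

/-- The super-diagonal sum of `archUnipotent e` is the infinite adele `(e₀₁, 0)`. [folklore] -/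
theorem superdiagSum_archUnipotent (e : ArchBlockSpace 2 1 K) :
    superdiagSum ⟨archUnipotent 2 1 K e, archUnipotent_mem e⟩ =
      infiniteAdeleInl K ((InfiniteAdeleRing.ringEquiv_mixedSpace K).symm (e pos₀₁)) := by
  have hmat : ((archUnipotent 2 1 K e : GL (Fin 2) (AdeleRing (𝓞 K) K)) : Matrix (Fin 2) (Fin 2) (AdeleRing (𝓞 K) K)) =
      1 + ((archBlock 2 1 K e : blockNilpotent 2 1 (AdeleRing (𝓞 K) K)) : Matrix (Fin 2) (Fin 2) (AdeleRing (𝓞 K) K)) :=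
    rfl
  rw [superdiagSum_def]
  simp only [Fin.sum_univ_two, Fin.val_zero, Fin.val_one, zero_add, Nat.reduceEqDiff, if_true, if_false,
    add_zero]
  change ((archUnipotent 2 1 K e : GL (Fin 2) (AdeleRing (𝓞 K) K)) : Matrix (Fin 2) (Fin 2) (AdeleRing (𝓞 K) K)) 0 1 = _
  rw [hmat, Matrix.add_apply, Matrix.one_apply_ne (by decide), zero_add]
  refine Prod.ext ?_ ?_
  · rw [fst_archBlock_apply]
    exact congrArg _ (blockMatrixOf_apply_coe e pos₀₁)
  · rw [snd_archBlock_apply]; rfl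

/-- Upper unitriangular `2 × 2` matrices commute. [folklore] -/
theorem mul_comm_of_mem {R : Type*} [CommRing R] {u v : GL (Fin 2) R}
    (hu : u ∈ upperUnitriangular (Fin 2) R) (hv : v ∈ upperUnitriangular (Fin 2) R) : u * v = v * u := by
  rw [mem_upperUnitriangular_iff] at hu hv
  have hu10 : (u : Matrix (Fin 2) (Fin 2) R) 1 0 = 0 := hu.1 (show ((0 : Fin 2) : ℕ) < ((1 : Fin 2) : ℕ) by decide)
  have hv10 : (v : Matrix (Fin 2) (Fin 2) R) 1 0 = 0 := hv.1 (show ((0 : Fin 2) : ℕ) < ((1 : Fin 2) : ℕ) by decide)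
  refine Units.ext (Matrix.ext fun i j => ?_)
  rw [Units.val_mul, Units.val_mul, Matrix.mul_apply, Matrix.mul_apply, Fin.sum_univ_two, Fin.sum_univ_two]
  fin_cases i <;> fin_cases j <;>
    simp only [Fin.zero_eta, Fin.mk_one, Fin.isValue, hu10, hv10, hu.2, hv.2] <;> ring

/-! ### Cusp forms invariant under the archimedean unipotents vanish -/

/-- A rational number `k₀` with `Tr_{K/ℚ}(k₀) = ½`. [folklore] -/
theorem exists_trace_eq_half : ∃ k₀ : K, Algebra.trace ℚ K k₀ = 1 / 2 := by
  refine ⟨algebraMap ℚ K (1 / (2 * Module.finrank ℚ K)), ?_⟩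
  rw [Algebra.trace_algebraMap, nsmul_eq_mul]
  have : (Module.finrank ℚ K : ℚ) ≠ 0 := by exact_mod_cast Module.finrank_pos.ne'
  field_simp

/-- Tate's character is `-1` on an infinite adele of trace `½`. [cite: CasselsFrohlichANT1967, Ch. XV §2.2] -/
theorem exists_adeleAddChar_infiniteAdeleInl_ne_one :
    ∃ y : InfiniteAdeleRing K, (adeleAddChar K (infiniteAdeleInl K y) : ℂ) ≠ 1 := by
  obtain ⟨k₀, hk₀⟩ := exists_trace_eq_half (K := K)
  refine ⟨algebraMap K (InfiniteAdeleRing K) k₀, ?_⟩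
  rw [adeleAddChar_infiniteAdeleInl, infiniteAdeleTrace_algebraMap, hk₀, Real.fourierChar_apply]
  have h : Complex.exp (2 * Real.pi * ((-(1 / 2 : ℚ) : ℝ) : ℂ) * Complex.I) = -1 := by
    have : (2 * Real.pi * ((-(1 / 2 : ℚ) : ℝ) : ℂ) * Complex.I) = -(Real.pi * Complex.I) := by
      push_cast; ring
    rw [this, Complex.exp_neg, Complex.exp_pi_mul_I, inv_neg, inv_one]
  push_cast at h ⊢
  rw [h]
  norm_num

/-- **A cusp form on `GL₂(𝔸_K)` invariant under the archimedean upper unipotents vanishes.**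
[cite: Shalika1974, §5 Thm. 5.9] [cite: Harder1987, §3.1] -/
theorem eq_zero_of_archUnipotent_mul {hcpt : isCompact_glFiniteIntegralLevel 2 K}
    {φ : GL (Fin 2) (AdeleRing (𝓞 K) K) → ℂ} (hφ : φ ∈ cuspFormsGL 2 K hcpt)
    (hinv : ∀ (e : ArchBlockSpace 2 1 K) (g : GL (Fin 2) (AdeleRing (𝓞 K) K)),
      φ (archUnipotent 2 1 K e * g) = φ g) :
    φ = 0 := by
  -- topological and measurable structures on `𝔸_K`, `GL₂(𝔸_K)` and `N₂(𝔸_K)` (as in `CuspidalMautnerGL2`)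
  haveI : T2Space (AdeleRing (𝓞 K) K) := t2Space_adeleRing K
  letI : MeasurableSpace (AdeleRing (𝓞 K) K) := borel _
  haveI : BorelSpace (AdeleRing (𝓞 K) K) := ⟨rfl⟩
  haveI : T2Space (GL (Fin 2) (AdeleRing (𝓞 K) K)) := t2Space_gl 2 K
  haveI : LocallyCompactSpace (GL (Fin 2) (AdeleRing (𝓞 K) K)) :=
    AdelicGroupData.locallyCompactSpace_generalLinearGroup_adeleRing K (Fin 2)
  haveI : SecondCountableTopology (GL (Fin 2) (AdeleRing (𝓞 K) K)) :=
    secondCountableTopology_generalLinearGroup_adeleRing K (Fin 2)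
  haveI : LocallyCompactSpace ↥(adelicUnipotent 2 K) := (isClosed_adelicUnipotent 2 K).locallyCompactSpace
  haveI hν₀R : (Measure.haar : Measure ↥(adelicUnipotent 2 K)).IsMulRightInvariant :=
    isMulRightInvariant_of_isHaarMeasure_adelicUnipotent _
  have hψ : IsGlobalAddChar K (adeleAddChar K) := isGlobalAddChar_adeleAddChar (K := K)
  have h𝓕 : IsFundamentalDomain ↥(rationalUnipotent 2 K) (unipotentTateDomain 2 K)
      (Measure.haar : Measure ↥(adelicUnipotent 2 K)) :=
    isFundamentalDomain_unipotentTateDomain _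
  have hφ𝒜 := cuspFormsGL_le_automorphicForms 2 K hcpt hφ
  have hφinvK : IsLeftInvariant (AdelicGroupData.gl 2 K) φ := isLeftInvariant_of_mem_automorphicForms hφ𝒜
  set W : GL (Fin 2) (AdeleRing (𝓞 K) K) → ℂ :=
    whittakerCoeff (Measure.haar : Measure ↥(adelicUnipotent 2 K)) (unipotentTateDomain 2 K) (adeleAddChar K) φ
    with hW
  -- `W(n_∞ g) = ψ(n_∞) W(g)`
  have hWleft : ∀ (e : ArchBlockSpace 2 1 K) (g : GL (Fin 2) (AdeleRing (𝓞 K) K)),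
      W (archUnipotent 2 1 K e * g) =
        whittakerCharFun (adeleAddChar K) ⟨archUnipotent 2 1 K e, archUnipotent_mem e⟩ * W g :=
    fun e g => whittakerCoeff_unipotent_mul (ν := (Measure.haar : Measure ↥(adelicUnipotent 2 K)))
      (𝓕 := unipotentTateDomain 2 K) (ψ := adeleAddChar K) h𝓕 hψ hφinvK
      ⟨archUnipotent 2 1 K e, archUnipotent_mem e⟩ g
  -- `W(n_∞ g) = W(g)` (`N₂` abelian, `φ` left `n_∞`-invariant)
  have hWinv : ∀ (e : ArchBlockSpace 2 1 K) (g : GL (Fin 2) (AdeleRing (𝓞 K) K)),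
      W (archUnipotent 2 1 K e * g) = W g := by
    intro e g
    simp only [hW, whittakerCoeff_def]
    congr 1
    refine setIntegral_congr_fun₀ ?_ ?_
    · exact h𝓕.nullMeasurableSet
    · intro u _
      change φ ((u : GL (Fin 2) (AdeleRing (𝓞 K) K)) * (archUnipotent 2 1 K e * g)) * _ =
        φ ((u : GL (Fin 2) (AdeleRing (𝓞 K) K)) * g) * _
      rw [← mul_assoc, mul_comm_of_mem u.2 (archUnipotent_mem e), mul_assoc, hinv]
  -- the character is not trivial on the archimedean unipotents
  obtain ⟨y, hy⟩ := exists_adeleAddChar_infiniteAdeleInl_ne_one (K := K)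
  set e₀ : ArchBlockSpace 2 1 K := fun _ => InfiniteAdeleRing.ringEquiv_mixedSpace K y with he₀
  have hchar : whittakerCharFun (adeleAddChar K) ⟨archUnipotent 2 1 K e₀, archUnipotent_mem e₀⟩ =
      (adeleAddChar K (infiniteAdeleInl K y) : ℂ) := by
    rw [whittakerCharFun_apply, superdiagSum_archUnipotent]
    change (adeleAddChar K (infiniteAdeleInl K ((InfiniteAdeleRing.ringEquiv_mixedSpace K).symm
      (InfiniteAdeleRing.ringEquiv_mixedSpace K y))) : ℂ) = _
    rw [RingEquiv.symm_apply_apply]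
  -- `W ≡ 0`
  have hW0 : ∀ g, W g = 0 := fun g => by
    have h1 := hWleft e₀ g
    rw [hWinv, hchar] at h1
    have h2 : ((adeleAddChar K (infiniteAdeleInl K y) : ℂ) - 1) * W g = 0 := by rw [sub_mul, one_mul, ← h1, sub_self]
    exact (mul_eq_zero.1 h2).resolve_left (sub_ne_zero.2 hy)
  exact IsCuspFormGL.eq_zero_of_whittakerCoeff_eq_zero _ h𝓕 hψ (isCuspFormGL_of_mem_cuspFormsGL' hφ) hW0

/-! ### From the vanishing of the `𝔰𝔩₂(ℂ)`-Lie derivatives at the unique complex place -/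

omit [NumberField K] in
/-- For a totally complex field with a single infinite place `w₀`, every matrix over `K_∞` is the
image under `complexPlaceLie` of its `w₀`-component. [folklore] -/
theorem complexPlaceLie_eval [IsTotallyComplex K] (hK : Subsingleton (InfinitePlace K)) {m : ℕ}
    (w₀ : {w : InfinitePlace K // w.IsComplex}) (X : Matrix (Fin m) (Fin m) (mixedSpace K)) :
    complexPlaceLie m w₀ (Matrix.of fun i j => (X i j).2 w₀) = X := by
  ext i j : 1
  rw [complexPlaceLie_apply, Matrix.of_apply]
  refine Prod.ext ?_ ?_
  · funext w
    exact ((ImaginaryQuadratic.isEmpty_isReal K).false w).elim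
  · funext w
    have hw : w = w₀ := Subtype.ext (Subsingleton.elim _ _)
    subst hw
    exact Pi.single_eq_same _ _

/-- The twisted direction `Ad(g_∞⁻¹)(e E₁₂)` has trace zero. [folklore] -/
theorem trace_twistedBlockDir (g : GL (Fin 2) (AdeleRing (𝓞 K) K)) (e : ArchBlockSpace 2 1 K) :
    (twistedBlockDir 2 1 K g e).trace = 0 := by
  rw [twistedBlockDir, Matrix.trace_mul_cycle, Units.mul_inv, one_mul, Matrix.trace]
  refine Finset.sum_eq_zero fun i _ => ?_
  rw [Matrix.diag_apply, blockMatrixOf_apply_of_not]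
  rintro ⟨h1, h2⟩
  omega

/-- **A cusp form on `GL₂(𝔸_K)` killed by `𝔰𝔩₂(ℂ)` at the unique (complex) infinite place
vanishes**: if `K` has one infinite place `w₀` and `X φ = 0` for all `X = φ_{w₀}(Y)`, `tr Y = 0`,
then `φ = 0` (the hypothesis `hnoinv` of `GL2CUnitaryKTypes.exists_isHW_two_mul` for cusp forms).
[cite: Harder1987, §3.1] [cite: MoeglinWaldspurger1995, proof of Lemma I.2.10] -/
theorem eq_zero_of_lieDeriv_placeLie_eq_zero [IsTotallyComplex K] (hK : Subsingleton (InfinitePlace K))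
    {hcpt : isCompact_glFiniteIntegralLevel 2 K} {φ : GL (Fin 2) (AdeleRing (𝓞 K) K) → ℂ}
    (hφ : φ ∈ cuspFormsGL 2 K hcpt)
    (h : ∀ Y : Matrix (Fin 2) (Fin 2) ℂ, Y.trace = 0 →
      lieDeriv (glArch 2 K) (ComplexPlace.placeLie 2 (ImaginaryQuadratic.complexPlace K) Y) φ = 0) :
    φ = 0 := by
  refine eq_zero_of_archUnipotent_mul hφ fun e g => ?_
  have hsm : IsArchSmooth (glArch 2 K) φ :=
    automorphicForms_le_archSmooth _ (cuspFormsGL_le_automorphicForms 2 K hcpt hφ)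
  -- the twisted direction is `φ_{w₀}` of a trace-zero matrix, so its Lie derivative kills `φ`
  have hYX : lieOf (twistedBlockDir 2 1 K g e) = ComplexPlace.placeLie 2 (ImaginaryQuadratic.complexPlace K)
      (Matrix.of fun i j => (twistedBlockDir 2 1 K g e i j).2 (ImaginaryQuadratic.complexPlace K)) :=
    Subtype.ext (complexPlaceLie_eval hK _ _).symm
  have htr : Matrix.trace (Matrix.of fun i j => (twistedBlockDir 2 1 K g e i j).2 (ImaginaryQuadratic.complexPlace K)) = 0 := by
    have h1 := congrArg (fun t : mixedSpace K => t.2 (ImaginaryQuadratic.complexPlace K)) (trace_twistedBlockDir g e)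
    simp only [Matrix.trace, Matrix.diag_apply, Prod.snd_sum, Finset.sum_apply, Prod.snd_zero,
      Pi.zero_apply] at h1
    simpa [Matrix.trace, Matrix.diag_apply] using h1
  have hL : lieDeriv (glArch 2 K) (lieOf (twistedBlockDir 2 1 K g e)) φ = 0 := by rw [hYX]; exact h _ htr
  -- so `s ↦ φ((1 + s e) g)` is constant
  have hder : ∀ s : ℝ, HasDerivAt (fun s : ℝ => φ (archUnipotent 2 1 K (0 + s • e) * g)) 0 s := fun s => by
    have := hsm.hasDerivAt_archUnipotent g 0 e s
    rwa [hL, Pi.zero_apply] at this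
  have hconst := is_const_of_deriv_eq_zero (fun s => (hder s).differentiableAt) (fun s => (hder s).deriv) 1 0
  simp only [one_smul, zero_smul, zero_add, archUnipotent_zero, one_mul] at hconst
  exact hconst

end GL2ArchUnipotent

end Literature.NumberTheory.Automorphic

end
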